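import Literature.NumberTheory.IwasawaTheory.ClassicalMuVanishesKurodaTower
import Literature.NumberTheory.IwasawaTheory.ClassicalMuVanishesDivisionFieldThree
import Literature.NumberTheory.SerreUniformity.SplitCartan
import Mathlib.GroupTheory.PGroup
import HarnessLib

set_option autoImplicit false

/-!
# `μ = 0` for `ℚ(E[5])_cyc` from a mod-5 image in the index-2 subgroup `⟨(0 1; 2 0), diag(1,4)⟩ ≅ M₁₆` of the split Cartan
# normaliser `C_s⁺(5)`: ONE `μ`-input (`ℚ(P₁)`, octic), growth-fact-free, modulo Ferrero–Washington alone

Topic `NumberTheory/IwasawaTheory` (namespace = path).  THEOREM-ONLY file (no definition, no named fact, no `sorry`); cell `bsd-potss`,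
seat `bsd-potss-k8t-c4` g18 (supports the KT U₀-ns node stmt-BirchSwinnertonDyer-19202 → 19982 and the Conj-A items 19413 / 19916 at the
row 446400hu1 @ 5; closes nothing).  The split-Cartan road of the cell (`ClassicalMuVanishesSplitCartanFive{Descent,Image}`,
`ClassicalMuVanishesDivisionFieldFive`; seat `conjA-anchor` g11) treats the FULL normaliser `C_s⁺(5)` (order `32`, commutator subgroup
`⟨diag(2,3)⟩ ≅ C₄`) and needs FOUR `μ`-inputs and the basis elements `diag(2,1)`, `diag(1,2)`, `(0 1; 1 0)`.  A curve whose mod-5 image is the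
INDEX-2 subgroup

  `G₁₆ = {c·1, c·diag(1,4), c·(0 1; 2 0), c·(0 1; 3 0) : c ∈ 𝔽₅ˣ} = ⟨A, s⟩`,  `A = (0 1; 2 0)` (order `8`, `A² = 2`, `A⁴ = −1`), `s = diag(1,4)`,

(`s A s⁻¹ = −A = A⁵`: the modular group `M₁₆` of order `16`; Cartan part `{diag(a, ±a)} ≅ C₄ × C₂`; `diag(2,1) ∉ G₁₆`) is outside that
basis shape, but is EASIER: `[G₁₆, G₁₆] = {±1}` lies in the central involution `z = −1 = A⁴`, `s` is a non-central involution and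
`A s A⁻¹ = −s = z s`.  This is verbatim the hypothesis set of the cell's growth-fact-free `D₄` census form
`classicalMuVanishes_of_isCyclotomic_of_kuroda_rat` (Kuroda's `V₄ = {1, z, s, zs}` relation at every layer of the cyclotomic tower,
[Lemmermeyer1994] §1 odd part; supports `L^{⟨z⟩}` and `L^{⟨z,s⟩}` abelian over `ℚ` ⇒ Ferrero–Washington; `L^{⟨zs⟩} ≅ L^{⟨s⟩}`), so that

  **`μ = 0` for every cyclotomic `ℤ_5`-extension of `L = ℚ(E[5])` ⟸ `μ = 0` for every cyclotomic `ℤ_5`-extension of `L^{⟨s⟩} = ℚ(P₁)`**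

(`P₁ = e⁻¹(1,0)`, stabiliser `{1, s}`, `[ℚ(P₁) : ℚ] = 8`), modulo `ferreroWashington1979_classicalMuVanishes` ALONE — no growth theorem,
no Coates–Sujatha input at this level.

* `classicalMuVanishes_of_isCyclotomic_of_splitCartanIndexTwo_five_fixedField` — group level: `L/ℚ` finite Galois, `ρ : Gal(L/ℚ) →* M₂(𝔽₅)`
  injective with every `ρ g ∈ splitCartanNormalizer 5` satisfying `(ρ g)₁₁ ∈ {(ρ g)₀₀, 4(ρ g)₀₀}` and `(ρ g)₁₀ ∈ {2(ρ g)₀₁, 3(ρ g)₀₁}`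
  (i.e. `ρ g ∈ G₁₆`), `ρ s = diag(1,4)`, `ρ a = (0 1; 2 0)`.
* `classicalMuVanishes_divisionField_of_splitCartanIndexTwoBasis_five` — the `ℚ(E[5])`-level form through the tree's
  `exists_matrixRep_divisionField` in a basis `e` of `E[5]`, with `σ_s, σ_a ∈ Γ_ℚ` acting as `diag(1,4)`, `(0 1; 2 0)`; the single input is
  «`μ = 0` for every cyclotomic `ℤ_5`-extension of the fixed field of `⟨σ̄_s⟩` in `ℚ(E[5])`» (`= ℚ(P₁)`), the output is verbatim the
  hypothesis of `CoatesSujatha2005.thm34_fineSelmerDual_moduleFinite_of_classicalMuVanishes_divisionField` at `p = 5`.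

All finite facts about the `16` matrices are `decide`d on entry-parametrised shapes (`c·1`, `c·diag(1,4)`, `c·A`, `c·(0 1;3 0)`).  Census use
(cell `bsd-potss`, KT U₀-ns row 446400hu1 @ 5, image of order `16` in `N_s(5)` with Cartan part `{ab square}`, kit j309300 / j310850):
`ℚ(P₁) ≅ ℚ[x]/(x⁸ − 120x⁴ − 360x² + 720)`, `h = 2`, one prime above `5` — Iwasawa 1956.

References: [Lemmermeyer1994] §1 (Kuroda's class number formula, odd part); [Washington1997] §7.5 (Ferrero–Washington), §13.1;
[Serre1972] §2.2 (split Cartan subgroups and their normalisers); [BiasseEtAl2022] Example 2.5 (the `V₄` norm relation).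
-/

noncomputable section

open scoped NumberField Matrix

open Field IntermediateField WeierstrassCurve Literature.NumberTheory.EllipticCurves Literature.NumberTheory.GaloisRepresentations
  Literature.NumberTheory.SerreUniformity

namespace Literature.NumberTheory.IwasawaTheory

/-! ### §0 Finite facts about `G₁₆ = ⟨(0 1; 2 0), diag(1,4)⟩ ⊂ C_s⁺(5)` (by `decide`) -/

section Matrices

/-- An element `M ∈ splitCartanNormalizer 5` with `M₁₁ ∈ {M₀₀, 4M₀₀}` and `M₁₀ ∈ {2M₀₁, 3M₀₁}` has one of the four shapes `c·1`,
`c·diag(1,4)`, `c·(0 1; 2 0)`, `c·(0 1; 3 0)` with `c ≠ 0`. [folklore] -/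
private theorem shape_of_mem_indexTwo₅ {M : Matrix (Fin 2) (Fin 2) (ZMod 5)} (hM : M ∈ splitCartanNormalizer 5)
    (hd : M 1 1 = M 0 0 ∨ M 1 1 = 4 * M 0 0) (ha : M 1 0 = 2 * M 0 1 ∨ M 1 0 = 3 * M 0 1) :
    ∃ c : ZMod 5, c ≠ 0 ∧ (M = !![c, 0; 0, c] ∨ M = !![c, 0; 0, 4 * c] ∨ M = !![0, c; 2 * c, 0] ∨ M = !![0, c; 3 * c, 0]) := by
  obtain ⟨hdet, h | h⟩ := hM
  · refine ⟨M 0 0, ?_, ?_⟩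
    · intro h0
      apply hdet
      simp [Matrix.det_fin_two, h.1, h.2, h0]
    · rcases hd with hd | hd
      · exact Or.inl (Matrix.ext fun i j => by fin_cases i <;> fin_cases j <;> simp [h.1, h.2, hd])
      · exact Or.inr (Or.inl (Matrix.ext fun i j => by fin_cases i <;> fin_cases j <;> simp [h.1, h.2, hd]))
  · refine ⟨M 0 1, ?_, ?_⟩
    · intro h0
      apply hdet
      simp [Matrix.det_fin_two, h.1, h.2, h0]
    · rcases ha with ha | ha
      · exact Or.inr (Or.inr (Or.inl (Matrix.ext fun i j => by fin_cases i <;> fin_cases j <;> simp [h.1, h.2, ha])))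
      · exact Or.inr (Or.inr (Or.inr (Matrix.ext fun i j => by fin_cases i <;> fin_cases j <;> simp [h.1, h.2, ha])))

/-- In `G₁₆` every pair of elements commutes up to the central sign `−1 = diag(4,4)`: `M N = N M` or `M N = (−1)·(N M)` — the sixteen
shape combinations, parametrised by the two scalars. [folklore] -/
private theorem comm_shapes₅ : ∀ c c' : ZMod 5,
    ((!![c, 0; 0, c] : Matrix (Fin 2) (Fin 2) (ZMod 5)) * !![c', 0; 0, c'] = !![c', 0; 0, c'] * !![c, 0; 0, c]) ∧
    ((!![c, 0; 0, c] : Matrix (Fin 2) (Fin 2) (ZMod 5)) * !![c', 0; 0, 4 * c'] = !![c', 0; 0, 4 * c'] * !![c, 0; 0, c]) ∧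
    ((!![c, 0; 0, c] : Matrix (Fin 2) (Fin 2) (ZMod 5)) * !![0, c'; 2 * c', 0] = !![0, c'; 2 * c', 0] * !![c, 0; 0, c]) ∧
    ((!![c, 0; 0, c] : Matrix (Fin 2) (Fin 2) (ZMod 5)) * !![0, c'; 3 * c', 0] = !![0, c'; 3 * c', 0] * !![c, 0; 0, c]) ∧
    ((!![c, 0; 0, 4 * c] : Matrix (Fin 2) (Fin 2) (ZMod 5)) * !![c', 0; 0, c'] = !![c', 0; 0, c'] * !![c, 0; 0, 4 * c]) ∧
    ((!![c, 0; 0, 4 * c] : Matrix (Fin 2) (Fin 2) (ZMod 5)) * !![c', 0; 0, 4 * c'] = !![c', 0; 0, 4 * c'] * !![c, 0; 0, 4 * c]) ∧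
    ((!![c, 0; 0, 4 * c] : Matrix (Fin 2) (Fin 2) (ZMod 5)) * !![0, c'; 2 * c', 0] =
      !![4, 0; 0, 4] * (!![0, c'; 2 * c', 0] * !![c, 0; 0, 4 * c])) ∧
    ((!![c, 0; 0, 4 * c] : Matrix (Fin 2) (Fin 2) (ZMod 5)) * !![0, c'; 3 * c', 0] =
      !![4, 0; 0, 4] * (!![0, c'; 3 * c', 0] * !![c, 0; 0, 4 * c])) ∧
    ((!![0, c; 2 * c, 0] : Matrix (Fin 2) (Fin 2) (ZMod 5)) * !![c', 0; 0, c'] = !![c', 0; 0, c'] * !![0, c; 2 * c, 0]) ∧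
    ((!![0, c; 2 * c, 0] : Matrix (Fin 2) (Fin 2) (ZMod 5)) * !![c', 0; 0, 4 * c'] =
      !![4, 0; 0, 4] * (!![c', 0; 0, 4 * c'] * !![0, c; 2 * c, 0])) ∧
    ((!![0, c; 2 * c, 0] : Matrix (Fin 2) (Fin 2) (ZMod 5)) * !![0, c'; 2 * c', 0] = !![0, c'; 2 * c', 0] * !![0, c; 2 * c, 0]) ∧
    ((!![0, c; 2 * c, 0] : Matrix (Fin 2) (Fin 2) (ZMod 5)) * !![0, c'; 3 * c', 0] =
      !![4, 0; 0, 4] * (!![0, c'; 3 * c', 0] * !![0, c; 2 * c, 0])) ∧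
    ((!![0, c; 3 * c, 0] : Matrix (Fin 2) (Fin 2) (ZMod 5)) * !![c', 0; 0, c'] = !![c', 0; 0, c'] * !![0, c; 3 * c, 0]) ∧
    ((!![0, c; 3 * c, 0] : Matrix (Fin 2) (Fin 2) (ZMod 5)) * !![c', 0; 0, 4 * c'] =
      !![4, 0; 0, 4] * (!![c', 0; 0, 4 * c'] * !![0, c; 3 * c, 0])) ∧
    ((!![0, c; 3 * c, 0] : Matrix (Fin 2) (Fin 2) (ZMod 5)) * !![0, c'; 2 * c', 0] =
      !![4, 0; 0, 4] * (!![0, c'; 2 * c', 0] * !![0, c; 3 * c, 0])) ∧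
    ((!![0, c; 3 * c, 0] : Matrix (Fin 2) (Fin 2) (ZMod 5)) * !![0, c'; 3 * c', 0] = !![0, c'; 3 * c', 0] * !![0, c; 3 * c, 0]) := by
  decide

/-- `M N = N M` or `M N = (−1)·(N M)` for `M, N ∈ G₁₆`. [folklore] -/
private theorem mul_eq_or_of_mem_indexTwo₅ {M N : Matrix (Fin 2) (Fin 2) (ZMod 5)} (hM : M ∈ splitCartanNormalizer 5)
    (hMd : M 1 1 = M 0 0 ∨ M 1 1 = 4 * M 0 0) (hMa : M 1 0 = 2 * M 0 1 ∨ M 1 0 = 3 * M 0 1) (hN : N ∈ splitCartanNormalizer 5)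
    (hNd : N 1 1 = N 0 0 ∨ N 1 1 = 4 * N 0 0) (hNa : N 1 0 = 2 * N 0 1 ∨ N 1 0 = 3 * N 0 1) :
    M * N = N * M ∨ M * N = !![4, 0; 0, 4] * (N * M) := by
  obtain ⟨c, -, hc⟩ := shape_of_mem_indexTwo₅ hM hMd hMa
  obtain ⟨c', -, hc'⟩ := shape_of_mem_indexTwo₅ hN hNd hNa
  obtain ⟨f11, f12, f13, f14, f21, f22, f23, f24, f31, f32, f33, f34, f41, f42, f43, f44⟩ := comm_shapes₅ c c'
  rcases hc with rfl | rfl | rfl | rfl <;> rcases hc' with rfl | rfl | rfl | rfl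
  exacts [Or.inl f11, Or.inl f12, Or.inl f13, Or.inl f14, Or.inl f21, Or.inl f22, Or.inr f23, Or.inr f24, Or.inl f31, Or.inr f32,
    Or.inl f33, Or.inr f34, Or.inl f41, Or.inr f42, Or.inr f43, Or.inl f44]

/-- Every element of `G₁₆` has order dividing `8` (shapes). [folklore] -/
private theorem pow_eight_shapes₅ : ∀ c : ZMod 5, c ≠ 0 →
    (!![c, 0; 0, c] : Matrix (Fin 2) (Fin 2) (ZMod 5)) ^ 8 = 1 ∧ (!![c, 0; 0, 4 * c] : Matrix (Fin 2) (Fin 2) (ZMod 5)) ^ 8 = 1 ∧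
      (!![0, c; 2 * c, 0] : Matrix (Fin 2) (Fin 2) (ZMod 5)) ^ 8 = 1 ∧ (!![0, c; 3 * c, 0] : Matrix (Fin 2) (Fin 2) (ZMod 5)) ^ 8 = 1 := by
  decide

/-- Every element of `G₁₆` has order dividing `8`. [folklore] -/
private theorem pow_eight_eq_one_of_mem_indexTwo₅ {M : Matrix (Fin 2) (Fin 2) (ZMod 5)} (hM : M ∈ splitCartanNormalizer 5)
    (hMd : M 1 1 = M 0 0 ∨ M 1 1 = 4 * M 0 0) (hMa : M 1 0 = 2 * M 0 1 ∨ M 1 0 = 3 * M 0 1) : M ^ 8 = 1 := by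
  obtain ⟨c, hc0, hc⟩ := shape_of_mem_indexTwo₅ hM hMd hMa
  obtain ⟨h1, h2, h3, h4⟩ := pow_eight_shapes₅ c hc0
  rcases hc with rfl | rfl | rfl | rfl
  exacts [h1, h2, h3, h4]

/-- The relations among `A = (0 1; 2 0)` and `S = diag(1,4)` used below: `A⁴ = −1`, `A⁸ = 1`, `S² = 1`, `(−1)S = S(−1)`,
`A S = (−1) S A`. [folklore] -/
private theorem as_facts₅ :
    (!![0, 1; 2, 0] : Matrix (Fin 2) (Fin 2) (ZMod 5)) * !![0, 1; 2, 0] * (!![0, 1; 2, 0] * !![0, 1; 2, 0]) = !![4, 0; 0, 4] ∧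
    (!![4, 0; 0, 4] : Matrix (Fin 2) (Fin 2) (ZMod 5)) * !![4, 0; 0, 4] = 1 ∧
    (!![1, 0; 0, 4] : Matrix (Fin 2) (Fin 2) (ZMod 5)) * !![1, 0; 0, 4] = 1 ∧
    (!![4, 0; 0, 4] : Matrix (Fin 2) (Fin 2) (ZMod 5)) * !![1, 0; 0, 4] = !![1, 0; 0, 4] * !![4, 0; 0, 4] ∧
    (!![0, 1; 2, 0] : Matrix (Fin 2) (Fin 2) (ZMod 5)) * !![1, 0; 0, 4] = !![4, 0; 0, 4] * !![1, 0; 0, 4] * !![0, 1; 2, 0] := by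
  decide

end Matrices

/-! ### §1 The bridge (group level) -/

/-- **`μ = 0` for the cyclotomic `ℤ_5`-tower of `L` from a faithful `G₁₆`-valued representation of `Gal(L/ℚ)`, ONE input, modulo
Ferrero–Washington alone — fixed-field form.**  `L/ℚ` finite Galois; `ρ : Gal(L/ℚ) →* M₂(𝔽₅)` injective with every `ρ g` in
`splitCartanNormalizer 5` and of shape `c·1`, `c·diag(1,4)`, `c·(0 1; 2 0)` or `c·(0 1; 3 0)` (`himg`: the index-2 subgroup
`G₁₆ = ⟨(0 1; 2 0), diag(1,4)⟩ ≅ M₁₆` of `C_s⁺(5)`); `s, a ∈ Gal(L/ℚ)` with `ρ s = diag(1,4)`, `ρ a = (0 1; 2 0)`.  If `μ = 0` holds for every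
cyclotomic `ℤ_5`-extension of `L^{⟨s⟩}` (for `L = ℚ(E[5])`: `= ℚ(P₁)`, octic), then — under `ferreroWashington1979_classicalMuVanishes` — for
every cyclotomic `ℤ_5`-extension of `L`.  Proof: `z := a⁴` has `ρ z = −1`; commutators of `G₁₆` lie in `{1, −1} ⊆ ⟨z⟩` (`decide` on shapes),
`a s a⁻¹ = z s`, `g⁸ = 1` so `Gal(L/ℚ)` is a `2`-group and `5 ∤ [L:ℚ]`; now `classicalMuVanishes_of_isCyclotomic_of_kuroda_rat` (Kuroda's
`V₄ = {1, z, s, zs}` relation up the tower; no growth theorem). [cite: Lemmermeyer1994, §1 (Kuroda's class number formula, odd part)]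
[cite: Washington1997, §7.5, §13.1] [cite: Serre1972, §2.2 (split Cartan subgroups and their normalisers)] -/
theorem classicalMuVanishes_of_isCyclotomic_of_splitCartanIndexTwo_five_fixedField
    (hFW : ferreroWashington1979_classicalMuVanishes) [Fact (Nat.Prime 5)] (L : Type) [Field L] [NumberField L] [IsGalois ℚ L]
    (ρ : (L ≃ₐ[ℚ] L) →* Matrix (Fin 2) (Fin 2) (ZMod 5)) (hρ : Function.Injective ρ)
    (himg : ∀ g, ρ g ∈ splitCartanNormalizer 5 ∧ ((ρ g) 1 1 = (ρ g) 0 0 ∨ (ρ g) 1 1 = 4 * (ρ g) 0 0) ∧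
      ((ρ g) 1 0 = 2 * (ρ g) 0 1 ∨ (ρ g) 1 0 = 3 * (ρ g) 0 1))
    {s a : L ≃ₐ[ℚ] L} (hs : ρ s = !![1, 0; 0, 4]) (ha : ρ a = !![0, 1; 2, 0])
    (hμP : ∀ κE : ZpExtension ↥(fixedField (Subgroup.zpowers s)) 5, κE.IsCyclotomic → ClassicalMuVanishes κE)
    (κL : ZpExtension L 5) (hκL : κL.IsCyclotomic) : ClassicalMuVanishes κL := by
  obtain ⟨fA4, fZ2, fS2, fZS, fAS⟩ := as_facts₅
  -- the central involution `z = a⁴`, `ρ z = −1`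
  obtain ⟨z, hρz⟩ : ∃ z : L ≃ₐ[ℚ] L, ρ z = !![4, 0; 0, 4] := ⟨a * a * (a * a), by simp only [map_mul, ha]; exact fA4⟩
  have hz : z * z = 1 := hρ (by rw [map_mul, hρz, map_one]; exact fZ2)
  have hb : s * s = 1 := hρ (by rw [map_mul, hs, map_one]; exact fS2)
  have hzb : z * s = s * z := hρ (by rw [map_mul, map_mul, hρz, hs]; exact fZS)
  have hconj : ∃ g : L ≃ₐ[ℚ] L, g * s * g⁻¹ = z * s :=
    ⟨a, by rw [mul_inv_eq_iff_eq_mul]; exact hρ (by rw [map_mul, map_mul, map_mul, ha, hs, hρz]; exact fAS)⟩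
  -- commutators in `{1, z}`
  have hcomm : ∀ g h : L ≃ₐ[ℚ] L, g * h * g⁻¹ * h⁻¹ ∈ Subgroup.zpowers z := by
    intro g h
    have key : ∀ x : L ≃ₐ[ℚ] L, g * h = x * (h * g) → g * h * g⁻¹ * h⁻¹ = x := fun x hx => by
      rw [show g * h * g⁻¹ * h⁻¹ = (g * h) * (h * g)⁻¹ by group, hx]; group
    obtain ⟨hg, hgd, hga⟩ := himg g
    obtain ⟨hh, hhd, hha⟩ := himg h
    rcases mul_eq_or_of_mem_indexTwo₅ hg hgd hga hh hhd hha with h1 | h1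
    · rw [key 1 (by rw [one_mul]; exact hρ (by rw [map_mul ρ g h, map_mul ρ h g]; exact h1))]
      exact Subgroup.one_mem _
    · rw [key z (hρ (by rw [map_mul ρ g h, map_mul ρ z (h * g), map_mul ρ h g, hρz]; exact h1))]
      exact Subgroup.mem_zpowers _
  -- `Gal(L/ℚ)` is a `2`-group, so `5 ∤ [L : ℚ]`
  have hp : ¬ 5 ∣ Module.finrank ℚ L := by
    haveI : Fact (Nat.Prime 2) := ⟨Nat.prime_two⟩
    have h2 : IsPGroup 2 (L ≃ₐ[ℚ] L) := fun g => ⟨3, hρ (by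
      obtain ⟨hg, hgd, hga⟩ := himg g
      rw [map_pow, map_one]; exact pow_eight_eq_one_of_mem_indexTwo₅ hg hgd hga)⟩
    obtain ⟨n, hn⟩ := IsPGroup.iff_card.mp h2
    rw [← IsGalois.card_aut_eq_finrank, hn]
    intro h
    have h5 : (5 : ℕ) ∣ 2 := (Nat.prime_five).dvd_of_dvd_pow h
    omega
  exact classicalMuVanishes_of_isCyclotomic_of_kuroda_rat hFW (by decide) L hp hz hb hzb hconj hcomm hμP κL hκL

/-! ### §2 The `ℚ(E[5])`-level form -/

/-- `Γ_ℚ → Gal(ℚ(E[n])/ℚ)` is onto. [folklore] -/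
private theorem absRestrictNormalHom_surjective_idx₂ {F : Type*} [Field F] (E : IntermediateField F (AlgebraicClosure F))
    [Normal F E] : Function.Surjective (absRestrictNormalHom E) := fun g => by
  obtain ⟨σ, hσ⟩ := AlgEquiv.restrictNormalHom_surjective (AlgebraicClosure F) g
  exact ⟨(absoluteGaloisGroup.toAlgEquiv F).symm σ, hσ⟩

/-- Two matrices with the same action on the vectors `e P` are equal. [folklore] -/
private theorem matrix_eq_of_forall_mulVec_idx₂ {A : Type*} [AddCommGroup A] {n : ℕ} (e : A ≃+ (Fin 2 → ZMod n))
    {M N : Matrix (Fin 2) (Fin 2) (ZMod n)} (h : ∀ P : A, M *ᵥ e P = N *ᵥ e P) : M = N :=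
  Matrix.toLin'.injective (LinearMap.ext fun v => by
    rw [Matrix.toLin'_apply, Matrix.toLin'_apply, ← e.apply_symm_apply v, h])

/-- `…_splitCartanIndexTwo_five_fixedField` for any `ℚ`-algebra structure on `L` (all coincide: `Subsingleton (Algebra ℚ L)`).
[cite: Serre1972, §2.2 (split Cartan subgroups, normalisers)] [cite: Washington1997, §7.5, §13.1] -/
private theorem indexTwo_five_fixedField_alg (hFW : ferreroWashington1979_classicalMuVanishes) [Fact (Nat.Prime 5)]
    (L : Type) [Field L] [NumberField L] [alg : Algebra ℚ L] [IsGalois ℚ L]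
    (ρ : (L ≃ₐ[ℚ] L) →* Matrix (Fin 2) (Fin 2) (ZMod 5)) (hρ : Function.Injective ρ)
    (himg : ∀ g, ρ g ∈ splitCartanNormalizer 5 ∧ ((ρ g) 1 1 = (ρ g) 0 0 ∨ (ρ g) 1 1 = 4 * (ρ g) 0 0) ∧
      ((ρ g) 1 0 = 2 * (ρ g) 0 1 ∨ (ρ g) 1 0 = 3 * (ρ g) 0 1))
    {s a : L ≃ₐ[ℚ] L} (hs : ρ s = !![1, 0; 0, 4]) (ha : ρ a = !![0, 1; 2, 0])
    (hμP : ∀ κE : ZpExtension ↥(fixedField (Subgroup.zpowers s)) 5, κE.IsCyclotomic → ClassicalMuVanishes κE)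
    (κL : ZpExtension L 5) (hκL : κL.IsCyclotomic) : ClassicalMuVanishes κL := by
  have h : alg = DivisionRing.toRatAlgebra := Subsingleton.elim _ _
  subst h
  exact classicalMuVanishes_of_isCyclotomic_of_splitCartanIndexTwo_five_fixedField hFW L ρ hρ himg hs ha hμP κL hκL

/-- **`μ = 0` for `ℚ(E[5])_cyc` from a mod-5 image in `G₁₆ = ⟨(0 1; 2 0), diag(1,4)⟩ ≅ M₁₆`, ONE input, modulo Ferrero–Washington alone.**
`E/ℚ` elliptic; `e` a basis of `E[5]` in which every `σ ∈ Γ_ℚ` acts through a matrix `M ∈ splitCartanNormalizer 5` of shape `c·1`, `c·diag(1,4)`,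
`c·(0 1; 2 0)` or `c·(0 1; 3 0)` (`he`); `σ_s, σ_a ∈ Γ_ℚ` acting in the basis `e` as `diag(1,4)` and `(0 1; 2 0)` (they exist when the image is all of
`G₁₆`).  If `μ = 0` holds for every cyclotomic `ℤ_5`-extension of the fixed field in `ℚ(E[5])` of `⟨σ̄_s⟩` (`= ℚ(P₁)`, `P₁ = e⁻¹(1,0)`, degree `8`),
then for every cyclotomic `ℤ_5`-extension of `ℚ(E[5])`: the hypothesis of road (b) (`CoatesSujatha2005.thm34_…`) at `p = 5`.  No growth theorem;
one Kuroda `V₄` relation (`{±1, ±diag(1,4)}`) up the tower, the supports `ℚ(E[5])^{⟨−1⟩}` and `ℚ(E[5])^{⟨−1, σ̄_s⟩}` being abelian over `ℚ`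
(`[G₁₆, G₁₆] = {±1}`; Ferrero–Washington) and `ℚ(E[5])^{⟨−σ̄_s⟩} ≅ ℚ(P₁)` (conjugate by `σ̄_a`).
[cite: Lemmermeyer1994, §1 (Kuroda's class number formula, odd part)] [cite: Washington1997, §7.5, §13.1]
[cite: Serre1972, §2.2 (split Cartan subgroups and their normalisers)] -/
theorem classicalMuVanishes_divisionField_of_splitCartanIndexTwoBasis_five (hFW : ferreroWashington1979_classicalMuVanishes)
    [Fact (Nat.Prime 5)] (W : WeierstrassCurve ℚ) [W.IsElliptic] (e : W.geomTorsion (5 : ℕ) ≃+ (Fin 2 → ZMod 5))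
    (he : ∀ σ : absoluteGaloisGroup ℚ, ∃ M ∈ splitCartanNormalizer 5, (M 1 1 = M 0 0 ∨ M 1 1 = 4 * M 0 0) ∧
      (M 1 0 = 2 * M 0 1 ∨ M 1 0 = 3 * M 0 1) ∧ ∀ P : W.geomTorsion (5 : ℕ), e (σ • P) = M *ᵥ e P)
    (σs σa : absoluteGaloisGroup ℚ) (hσs : ∀ P : W.geomTorsion (5 : ℕ), e (σs • P) = !![1, 0; 0, 4] *ᵥ e P)
    (hσa : ∀ P : W.geomTorsion (5 : ℕ), e (σa • P) = !![0, 1; 2, 0] *ᵥ e P)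
    (hμP : haveI : NumberField ↥(W.divisionField 5) := NumberField.mk
      ∀ κE : ZpExtension ↥(fixedField (Subgroup.zpowers (absRestrictNormalHom (W.divisionField 5) σs))) 5,
        κE.IsCyclotomic → ClassicalMuVanishes κE) :
    haveI : NumberField ↥(W.divisionField 5) := NumberField.mk
    ∀ κL : ZpExtension ↥(W.divisionField 5) 5, κL.IsCyclotomic → ClassicalMuVanishes κL := by
  haveI : NumberField ↥(W.divisionField 5) := NumberField.mk
  intro κL hκL
  obtain ⟨ρ, hρ, hρe⟩ := exists_matrixRep_divisionField W 5 e
  have hπ := absRestrictNormalHom_surjective_idx₂ (W.divisionField 5)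
  have hmat : ∀ (σ : absoluteGaloisGroup ℚ) (M : Matrix (Fin 2) (Fin 2) (ZMod 5)),
      (∀ P : W.geomTorsion (5 : ℕ), e (σ • P) = M *ᵥ e P) → ρ (absRestrictNormalHom (W.divisionField 5) σ) = M :=
    fun σ M hM => matrix_eq_of_forall_mulVec_idx₂ e fun P => by rw [← hρe, hM]
  have himg' : ∀ g, ρ g ∈ splitCartanNormalizer 5 ∧ ((ρ g) 1 1 = (ρ g) 0 0 ∨ (ρ g) 1 1 = 4 * (ρ g) 0 0) ∧
      ((ρ g) 1 0 = 2 * (ρ g) 0 1 ∨ (ρ g) 1 0 = 3 * (ρ g) 0 1) := fun g => by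
    obtain ⟨σ, rfl⟩ := hπ g
    obtain ⟨M, hM, hMd, hMa, hMe⟩ := he σ
    rw [hmat σ M hMe]
    exact ⟨hM, hMd, hMa⟩
  exact @indexTwo_five_fixedField_alg hFW _ ↥(W.divisionField 5) _ _ (_) (W.isGalois_divisionField 5) ρ hρ himg' _ _
    (hmat σs _ hσs) (hmat σa _ hσa) hμP κL hκL

end Literature.NumberTheory.IwasawaTheory

end
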